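/-
Copyright (c) 2026 the pub-hodgecm-mathlib formalisation cell (harness21).  Prover seat hodgecm-mathlib-F0P2-p01 (g11), programme P2,
row B′ of the desk's OCC♭-GEN census (`F0/P2/CENSUS-OCCGEN-T5currency.F0P2-plan-g12.md` §1), 2026-09-01.  KERNEL module: THEOREMS ONLY
(no definition, no named fact, no `sorry`, no instance, no notation).
-/
import Literature.NumberTheory.Automorphic.Liu2021.ThetaLiftFromLineFinIntertwiner
import HarnessLib

/-!
# FLOOR-0 P2 · node B′ «χ-RESOLVED FINITE COMPONENT»: `pr_P [Θ̃_{Φ_∞ ⊗ Φ_f}(charCM χ̃_χ) ∘ ιA] ≠ 0 ⟹ P.HasFinComponent (rhoAtLine … ιV a χ)`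

Cell hodgecm-mathlib (D-0151), FLOOR 0; crux item H413 = stmt-HodgeConjecture-24833 (route `HCCMUnconditional`, no route verbs); programme P2,
sub-line E3-RELSIGN (`Cruxes/H413/Lines/F0_P2E3RelSign.lean`, ED. 2 «ONE MEASURE»), stub OCC♭∀ `stub_occFlatAll` (books #155′) and its planned
in-house pay-down line «OCC♭-GEN» (desk F0P2-plan (g12), PLAN-P2 v13 §2 + census addendum `F0/P2/CENSUS-OCCGEN-T5currency.F0P2-plan-g12.md`).
THEOREMS ONLY; `--supports stmt-HodgeConjecture-24833`.  HONEST LABEL: HC_CM is proved only modulo the printed citations until rung 0 closes;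
this file closes NO print letter — it is the χ-RESOLVED form of node B of the (C♯)hol interior, needed because OCC♭∀ prescribes the character `χ`.

## What is proved (all over ★ `ThetaLiftFromLineFinIntertwiner` §2, ★ `Def411WeilCarriersIrreducibleOrZeroAtLine`, ★ `DiscreteAutomorphicRepHasFinComponentOfIrreducible`)
The booked node-B letter ★ `Liu2021.meetsThetaLiftFromLine_hasFinComponent_rhoAtLine` (closer ★ `F0P2NodeBFinComponentHolds`) starts from the
χ-BLIND seam `MeetsThetaLiftFromLine` and concludes `∃ χ, P.HasFinComponent (rhoAtLine … ιV a χ)`.  OCC♭∀ needs the statement for the GIVEN `χ`: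
* §1 (any rank `N`, `2 ≤ n'`, canonical finite transport `ιV = finPart ∘ cmAdelicFrameTransport ∘ finAdelicToAdelic`)
  **`hasFinComponent_rhoAtLine_of_starProjection_ne_zero`** — if, for the discrete `P ⊂ L²([U(H)], μA)`, some archimedean Schwartz factor `Φ_∞`
  and some finite Schwartz–Bruhat `Φ_f`, the orthogonal projection `pr_P [Θ̃_{R_e E(Φ_∞ ⊗ Φ_f)}(charCM χ̃_χ) ∘ ιA]` of the theta class of the line
  `⟨a⟩` at the `μ`-splitting and the character `χ ∈ Chi` is NON-ZERO, then `P.HasFinComponent (rhoAtLine … ιV a χ)`.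
  PROOF: the finite theta intertwiner `θ̄_{Φ_∞} : rhoAtLine … ιV a χ → P_f` of ★ `exists_intertwiningMap_rhoAtLine_finRep` has
  `θ̄_{Φ_∞}(mk Φ_f) = pr_P [...] ≠ 0`; `rhoAtLine … ιV a χ` is irreducible-or-zero ([Liu2021, Lem. D.1], ★
  `isIrreducibleOrZero_rhoVAtLine_chiSplittingLine_comp_of_surjective`, `ιV` onto ★ `finPart_cmAdelicFrameTransport_finAdelicToAdelic_surjective`),
  so `θ̄_{Φ_∞}` is injective (★ `DiscreteAutomorphicRep.hasFinComponent_of_isIrreducibleOrZero`).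
* §1 **`…_of_coe`** — the same for ANY `ιV` pinned by the matrix formula `↑(ιV k) = g_f⁻¹ k g_f` (the `hιV` binder of OCC♭∀ ∕ (C♯)hol; it IS the
  canonical transport, ★ `eq_finPart_cmAdelicFrameTransport_finAdelicToAdelic_of_coe`).
* §2 (`N = 3`, the frame of OCC♭∀ ∕ E3♭∞) **`hasFinComponent_rhoAtLine_three_of_starProjection_ne_zero{,_of_coe}`** — the rank hypothesis discharged
  (`n' = 3`).
All statements are measure-generic (`(P : DiscreteAutomorphicRep … μA)` for any automorphic `μA`, desk word 2026-09-01T10:29:23Z (ii)).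

## References
* [Liu2021] Y. Liu, *Fourier–Jacobi cycles and arithmetic relative trace formula*, Camb. J. Math. 9 (2021) = arXiv:2102.11518, proof of Prop. 4.13
  Case 1 (l. 2136–2137, p. 48) and «Conversely» (l. 2145–2149); Def. 4.11 (l. 2090–2096); App. D §D.1 Step 3 (l. 5221), Lemma D.1 (l. 5227).
* [Rallis1984] S. Rallis, *On the Howe duality conjecture*, Compositio Math. 51 (1984), proof of Thm. 1.2.2 p. 356.
* [GelbartRogawski1991] S. Gelbart, J. Rogawski, Invent. Math. 105 (1991), §3.2 p. 457, Prop. 3.1.1.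
* [BorelJacquet1979] A. Borel, H. Jacquet, PSPM 33.1 (1979), §4.1, §4.6.
-/

set_option autoImplicit false

-- the mandated namespace has the single-problem summit's repeated segment (`HodgeConjecture.HodgeConjecture`)
set_option linter.dupNamespace false

noncomputable section

open NumberField MeasureTheory IsDedekindDomain
open scoped Matrix Kronecker ComplexOrder ENNReal SchwartzMap TensorProduct Classical

namespace Summit.HodgeConjecture.HodgeConjecture.Cruxes.H413.F0P2sNodeBPrime

open Literature.NumberTheory.Automorphic Literature.NumberTheory.Automorphic.UnitaryGroup
open Literature.NumberTheory.Automorphic.UnitaryGroup.CotangentForms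
open Literature.NumberTheory.Automorphic.IdeleClassGroup
open Literature.NumberTheory.Automorphic.Liu2021
open Literature.NumberTheory.Automorphic.Liu2021.Def411WeilCarriers
open Literature.NumberTheory.Automorphic.Liu2021.Def411WeilCarriersDoubling
open Literature.NumberTheory.GelbartRogawski1991 Literature.NumberTheory.GelbartRogawski1991.UnitaryDualPair
open Literature.NumberTheory.GelbartRogawski1991.UnitaryDualPair.WeilCoinv
open Literature.NumberTheory.Weil1964
open Literature.RepresentationTheory Literature.RepresentationTheory.Liu2021
open Literature.RepresentationTheory.CompactGroups

/-! ## §1 Any rank `N` (`2 ≤ n'`): `pr_P [Θ̃_{Φ_∞ ⊗ Φ_f}(charCM χ̃_χ) ∘ ιA] ≠ 0 ⟹ P.HasFinComponent (rhoAtLine … ιV a χ)` -/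

section AnyRank

variable (L : Type) [Field L] [NumberField L] [IsCMField L] (N : ℕ) (H : Matrix (Fin N) (Fin N) L)
  {n' : ℕ} (e₁ : Fin N × Fin 1 ≃ Fin n') (hn' : 2 ≤ n') (dV : Fin N → L) (hdV : ∀ i, IsCMField.complexConj L (dV i) = dV i)
  (hdV0 : ∀ i, dV i ≠ 0) (g : GL (Fin N) L)
  (hg : ((g : Matrix (Fin N) (Fin N) L).map (cmConjRingHom L))ᵀ * H * (g : Matrix (Fin N) (Fin N) L) = Matrix.diagonal dV)
  (μ : Literature.NumberTheory.Automorphic.IdeleClassGroup L →ₜ* Circle) (hμ : IsConjugateSymplectic L μ) (a : (↥(maximalRealSubfield L))ˣ)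
  (hρ : HasThetaMajorants fun
      (p : ↥(UnitaryGroup.adelic (↥(maximalRealSubfield L)) L (IsCMField.complexConj L) N (Matrix.diagonal dV)) × ↥(UnitaryGroup.adelic (↥(maximalRealSubfield L)) L (IsCMField.complexConj L) 1 (JW (↥(maximalRealSubfield L)) L a))) (Φ : piSchwartzBruhat (↥(maximalRealSubfield L)) (Fin n')) =>
        pairRep (↥(maximalRealSubfield L)) L (IsCMField.complexConj L) N 1 e₁ (Matrix.diagonal dV) (JW (↥(maximalRealSubfield L)) L a)
          (chiSplittingLine L e₁ dV hdV hdV0 (toHeckeCharacter L μ) (isUnitary_toHeckeCharacter L μ)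
            ((isOscillatorChar_toHeckeCharacter_iff μ).mpr hμ) (TW (↥(maximalRealSubfield L)) a)
            (isUnit_det_TW (↥(maximalRealSubfield L)) a) (JW (↥(maximalRealSubfield L)) L a) (JW_eq (↥(maximalRealSubfield L)) L a))
          p Φ)
  [CompactSpace (↥(UnitaryGroup.adelic (↥(maximalRealSubfield L)) L (IsCMField.complexConj L) N (Matrix.diagonal dV)) ⧸ (UnitaryGroup.toAdelic (↥(maximalRealSubfield L)) L (IsCMField.complexConj L) N (Matrix.diagonal dV)).range)] [MeasurableSpace (↥(UnitaryGroup.adelic (↥(maximalRealSubfield L)) L (IsCMField.complexConj L) 1 (JW (↥(maximalRealSubfield L)) L a)) ⧸ (UnitaryGroup.toAdelic (↥(maximalRealSubfield L)) L (IsCMField.complexConj L) 1 (JW (↥(maximalRealSubfield L)) L a)).range)] [BorelSpace (↥(UnitaryGroup.adelic (↥(maximalRealSubfield L)) L (IsCMField.complexConj L) 1 (JW (↥(maximalRealSubfield L)) L a)) ⧸ (UnitaryGroup.toAdelic (↥(maximalRealSubfield L)) L (IsCMField.complexConj L) 1 (JW (↥(maximalRealSubfield L)) L a)).range)] (μW :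 Measure (↥(UnitaryGroup.adelic (↥(maximalRealSubfield L)) L (IsCMField.complexConj L) 1 (JW (↥(maximalRealSubfield L)) L a)) ⧸ (UnitaryGroup.toAdelic (↥(maximalRealSubfield L)) L (IsCMField.complexConj L) 1 (JW (↥(maximalRealSubfield L)) L a)).range)) [IsFiniteMeasure μW] [SMulInvariantMeasure ↥(UnitaryGroup.adelic (↥(maximalRealSubfield L)) L (IsCMField.complexConj L) 1 (JW (↥(maximalRealSubfield L)) L a)) (↥(UnitaryGroup.adelic (↥(maximalRealSubfield L)) L (IsCMField.complexConj L) 1 (JW (↥(maximalRealSubfield L)) L a)) ⧸ (UnitaryGroup.toAdelic (↥(maximalRealSubfield L)) L (IsCMField.complexConj L) 1 (JW (↥(maximalRealSubfield L)) L a)).range) μW]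
  (φ : 𝓢(((Fin N × Fin 1) → NumberField.mixedEmbedding.mixedSpace ↥(maximalRealSubfield L)), ℂ))
  {μA : Measure (adelicGroupData (↥(maximalRealSubfield L)) L (IsCMField.complexConj L) N H).automorphicQuotient}
  [(adelicGroupData (↥(maximalRealSubfield L)) L (IsCMField.complexConj L) N H).IsAutomorphicMeasure μA]
  [CompactSpace (adelicGroupData (↥(maximalRealSubfield L)) L (IsCMField.complexConj L) N H).automorphicQuotient]
  (P : DiscreteAutomorphicRep (adelicGroupData (↥(maximalRealSubfield L)) L (IsCMField.complexConj L) N H) μA)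
  (χ : Chi (↥(maximalRealSubfield L)) L (IsCMField.complexConj L))
  (Φf : FinSB (↥(maximalRealSubfield L)) (Fin N × Fin 1))

include hn' in
set_option maxHeartbeats 1600000 in
/-- **NODE B′ — the χ-RESOLVED FINITE COMPONENT of a discrete `P` meeting the theta class of the line `⟨a⟩` at the character `χ`**
([Liu2021, proof of Prop. 4.13, Case 1 «In other words … `π^∞ ≃ ω(μ, ε_e, χ)`» and the «Conversely» sentence]; [Rallis1984, Thm. 1.2.2 proof]):
at the CANONICAL finite transport `ιV = finPart ∘ cmAdelicFrameTransport ∘ finAdelicToAdelic`, if for some archimedean Schwartz factor `Φ_∞` and some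
finite Schwartz–Bruhat `Φ_f` the orthogonal projection onto `P` of the class `[Θ̃_{R_e E(Φ_∞ ⊗ Φ_f)}(charCM χ̃_χ) ∘ ιA] ∈ L²([U(H)], μA)` is non-zero, then
`P.HasFinComponent (rhoAtLine … ιV a χ)`: the finite theta intertwiner `θ̄_{Φ_∞}` (★ `exists_intertwiningMap_rhoAtLine_finRep`) is non-zero at `mk Φ_f`,
and `rhoAtLine … ιV a χ` is irreducible-or-zero ([Liu2021, Lem. D.1]; `ιV` onto), hence `θ̄_{Φ_∞}` is injective.
[cite: Liu2021, proof of Prop. 4.13 Case 1 (l. 2136–2137, p. 48) and l. 2145–2149; Def. 4.11 (l. 2090–2096); App. D Lemma D.1 (l. 5227)]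
[cite: Rallis1984, Thm. 1.2.2 proof p. 356] [cite: BorelJacquet1979, §4.6] -/
theorem hasFinComponent_rhoAtLine_of_starProjection_ne_zero
    (hne : haveI := normal_range_toAdelic_JW L a
      P.space.toSubmodule.starProjection
          (MemLp.toLp _ (memLp_toQuotFun_lineThetaLift L N H e₁ dV hdV hdV0 g hg μ hμ a hρ μW
            (piSBReindex (↥(maximalRealSubfield L)) e₁ (piSchwartzBruhatEquiv (↥(maximalRealSubfield L)) (Fin N × Fin 1) (φ ⊗ₜ[ℂ] Φf)))
            (charCM (chiQuot (↥(maximalRealSubfield L)) L (IsCMField.complexConj L) (Algebra.IsQuadraticExtension.finrank_eq_two _ L)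
              (IsCMField.complexConj_ne_one (K := L)) a χ)) μA 2)) ≠ 0) :
    P.HasFinComponent
      (rhoAtLine (↥(maximalRealSubfield L)) L (IsCMField.complexConj L) N e₁ (Matrix.diagonal dV)
        (complexConj_imagUnit L) (imagUnit_ne_zero L) (imagUnit_mul_self L) (realDiagonal_isSymm L dV hdV)
        (isUnit_det_realDiagonal L dV hdV hdV0) (realDiagonal_map L dV hdV).symm
        (fun b => isCompatible_chiSplittingLine L e₁ dV hdV hdV0 (toHeckeCharacter L μ)
          (isUnitary_toHeckeCharacter L μ) ((isOscillatorChar_toHeckeCharacter_iff μ).mpr hμ)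
          (TW (↥(maximalRealSubfield L)) b) (isSymm_TW (↥(maximalRealSubfield L)) b)
          (isUnit_det_TW (↥(maximalRealSubfield L)) b) (JW (↥(maximalRealSubfield L)) L b)
          (JW_eq (↥(maximalRealSubfield L)) L b))
        ((finPart (↥(maximalRealSubfield L)) L (IsCMField.complexConj L) N (Matrix.diagonal dV)).comp
          ((cmAdelicFrameTransport L N H dV g hg).comp (finAdelicToAdelic (↥(maximalRealSubfield L)) L (IsCMField.complexConj L) N H)))
        a χ) := by
  haveI := normal_range_toAdelic_JW L a
  obtain ⟨θ, hθv⟩ := exists_intertwiningMap_rhoAtLine_finRep L N H e₁ dV hdV hdV0 g hg μ hμ a hρ μW φ P χ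
  refine P.hasFinComponent_of_isIrreducibleOrZero ?_ θ (w := TwistedCoinv.mk _ _ Φf) ?_
  · exact isIrreducibleOrZero_rhoVAtLine_chiSplittingLine_comp_of_surjective L e₁ hn' dV hdV hdV0
      (toHeckeCharacter L μ) (isUnitary_toHeckeCharacter L μ) ((isOscillatorChar_toHeckeCharacter_iff μ).mpr hμ) a χ _
      (finPart_cmAdelicFrameTransport_finAdelicToAdelic_surjective L N H dV g hg)
  · intro h0
    apply hne
    have h1 := hθv Φf
    rw [h0] at h1
    rw [← h1]
    exact ZeroMemClass.coe_zero _

include hg hn' in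
set_option maxHeartbeats 1600000 in
/-- **Node B′ at a PINNED finite transport**: the same conclusion for ANY `ιV : U(H)(𝔸_{L⁺,f}) →* U(diag dV)(𝔸_{L⁺,f})` with the matrix formula
`↑(ιV k) = g_f⁻¹ · k · g_f` (the `hιV` binder of OCC♭∀ ∕ (C♯)hol ∕ node B) — it IS the canonical one (★ `eq_finPart_cmAdelicFrameTransport_finAdelicToAdelic_of_coe`).
[cite: Liu2021, proof of Prop. 4.13 Case 1 (l. 2136–2137, p. 48) and l. 2145–2149; Def. 4.11 (l. 2090–2096); App. D Lemma D.1 (l. 5227)]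
[cite: Rallis1984, Thm. 1.2.2 proof p. 356] [cite: BorelJacquet1979, §4.1, §4.6] -/
theorem hasFinComponent_rhoAtLine_of_starProjection_ne_zero_of_coe
    (ιV : finAdelic (↥(maximalRealSubfield L)) L (IsCMField.complexConj L) N H →*
      finAdelic (↥(maximalRealSubfield L)) L (IsCMField.complexConj L) N (Matrix.diagonal dV))
    (hιV : ∀ k, ((ιV k : finAdelic (↥(maximalRealSubfield L)) L (IsCMField.complexConj L) N (Matrix.diagonal dV)) :
          GL (Fin N) (FiniteAdeleRing (𝓞 L) L)) =
        (toFinAdeleGL L N g)⁻¹ * (k : GL (Fin N) (FiniteAdeleRing (𝓞 L) L)) * toFinAdeleGL L N g)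
    (hne : haveI := normal_range_toAdelic_JW L a
      P.space.toSubmodule.starProjection
          (MemLp.toLp _ (memLp_toQuotFun_lineThetaLift L N H e₁ dV hdV hdV0 g hg μ hμ a hρ μW
            (piSBReindex (↥(maximalRealSubfield L)) e₁ (piSchwartzBruhatEquiv (↥(maximalRealSubfield L)) (Fin N × Fin 1) (φ ⊗ₜ[ℂ] Φf)))
            (charCM (chiQuot (↥(maximalRealSubfield L)) L (IsCMField.complexConj L) (Algebra.IsQuadraticExtension.finrank_eq_two _ L)
              (IsCMField.complexConj_ne_one (K := L)) a χ)) μA 2)) ≠ 0) :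
    P.HasFinComponent
      (rhoAtLine (↥(maximalRealSubfield L)) L (IsCMField.complexConj L) N e₁ (Matrix.diagonal dV)
        (complexConj_imagUnit L) (imagUnit_ne_zero L) (imagUnit_mul_self L) (realDiagonal_isSymm L dV hdV)
        (isUnit_det_realDiagonal L dV hdV hdV0) (realDiagonal_map L dV hdV).symm
        (fun b => isCompatible_chiSplittingLine L e₁ dV hdV hdV0 (toHeckeCharacter L μ)
          (isUnitary_toHeckeCharacter L μ) ((isOscillatorChar_toHeckeCharacter_iff μ).mpr hμ)
          (TW (↥(maximalRealSubfield L)) b) (isSymm_TW (↥(maximalRealSubfield L)) b)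
          (isUnit_det_TW (↥(maximalRealSubfield L)) b) (JW (↥(maximalRealSubfield L)) L b)
          (JW_eq (↥(maximalRealSubfield L)) L b)) ιV a χ) := by
  obtain rfl := eq_finPart_cmAdelicFrameTransport_finAdelicToAdelic_of_coe L N H dV g hg ιV hιV
  exact hasFinComponent_rhoAtLine_of_starProjection_ne_zero L N H e₁ hn' dV hdV hdV0 g hg μ hμ a hρ μW φ P χ Φf hne

end AnyRank

/-! ## §2 The frame of OCC♭∀ ∕ E3♭∞ (`N = 3`): the rank hypothesis discharged -/

section RankThree

variable (L : Type) [Field L] [NumberField L] [IsCMField L] (H : Matrix (Fin 3) (Fin 3) L)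
  {n' : ℕ} (e₁ : Fin 3 × Fin 1 ≃ Fin n') (dV : Fin 3 → L) (hdV : ∀ i, IsCMField.complexConj L (dV i) = dV i)
  (hdV0 : ∀ i, dV i ≠ 0) (g : GL (Fin 3) L)
  (hg : ((g : Matrix (Fin 3) (Fin 3) L).map (cmConjRingHom L))ᵀ * H * (g : Matrix (Fin 3) (Fin 3) L) = Matrix.diagonal dV)
  (μ : Literature.NumberTheory.Automorphic.IdeleClassGroup L →ₜ* Circle) (hμ : IsConjugateSymplectic L μ) (a : (↥(maximalRealSubfield L))ˣ)
  (hρ : HasThetaMajorants fun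
      (p : ↥(UnitaryGroup.adelic (↥(maximalRealSubfield L)) L (IsCMField.complexConj L) 3 (Matrix.diagonal dV)) × ↥(UnitaryGroup.adelic (↥(maximalRealSubfield L)) L (IsCMField.complexConj L) 1 (JW (↥(maximalRealSubfield L)) L a))) (Φ : piSchwartzBruhat (↥(maximalRealSubfield L)) (Fin n')) =>
        pairRep (↥(maximalRealSubfield L)) L (IsCMField.complexConj L) 3 1 e₁ (Matrix.diagonal dV) (JW (↥(maximalRealSubfield L)) L a)
          (chiSplittingLine L e₁ dV hdV hdV0 (toHeckeCharacter L μ) (isUnitary_toHeckeCharacter L μ)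
            ((isOscillatorChar_toHeckeCharacter_iff μ).mpr hμ) (TW (↥(maximalRealSubfield L)) a)
            (isUnit_det_TW (↥(maximalRealSubfield L)) a) (JW (↥(maximalRealSubfield L)) L a) (JW_eq (↥(maximalRealSubfield L)) L a))
          p Φ)
  [CompactSpace (↥(UnitaryGroup.adelic (↥(maximalRealSubfield L)) L (IsCMField.complexConj L) 3 (Matrix.diagonal dV)) ⧸ (UnitaryGroup.toAdelic (↥(maximalRealSubfield L)) L (IsCMField.complexConj L) 3 (Matrix.diagonal dV)).range)] [MeasurableSpace (↥(UnitaryGroup.adelic (↥(maximalRealSubfield L)) L (IsCMField.complexConj L) 1 (JW (↥(maximalRealSubfield L)) L a)) ⧸ (UnitaryGroup.toAdelic (↥(maximalRealSubfield L)) L (IsCMField.complexConj L) 1 (JW (↥(maximalRealSubfield L)) L a)).range)] [BorelSpace (↥(UnitaryGroup.adelic (↥(maximalRealSubfield L)) L (IsCMField.complexConj L) 1 (JW (↥(maximalRealSubfield L)) L a)) ⧸ (UnitaryGroup.toAdelic (↥(maximalRealSubfield L)) L (IsCMField.complexConj L) 1 (JW (↥(maximalRealSubfield L)) L a)).range)]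 (μW : Measure (↥(UnitaryGroup.adelic (↥(maximalRealSubfield L)) L (IsCMField.complexConj L) 1 (JW (↥(maximalRealSubfield L)) L a)) ⧸ (UnitaryGroup.toAdelic (↥(maximalRealSubfield L)) L (IsCMField.complexConj L) 1 (JW (↥(maximalRealSubfield L)) L a)).range)) [IsFiniteMeasure μW] [SMulInvariantMeasure ↥(UnitaryGroup.adelic (↥(maximalRealSubfield L)) L (IsCMField.complexConj L) 1 (JW (↥(maximalRealSubfield L)) L a)) (↥(UnitaryGroup.adelic (↥(maximalRealSubfield L)) L (IsCMField.complexConj L) 1 (JW (↥(maximalRealSubfield L)) L a)) ⧸ (UnitaryGroup.toAdelic (↥(maximalRealSubfield L)) L (IsCMField.complexConj L) 1 (JW (↥(maximalRealSubfield L)) L a)).range) μW]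
  (φ : 𝓢(((Fin 3 × Fin 1) → NumberField.mixedEmbedding.mixedSpace ↥(maximalRealSubfield L)), ℂ))
  {μA : Measure (adelicGroupData (↥(maximalRealSubfield L)) L (IsCMField.complexConj L) 3 H).automorphicQuotient}
  [(adelicGroupData (↥(maximalRealSubfield L)) L (IsCMField.complexConj L) 3 H).IsAutomorphicMeasure μA]
  [CompactSpace (adelicGroupData (↥(maximalRealSubfield L)) L (IsCMField.complexConj L) 3 H).automorphicQuotient]
  (P : DiscreteAutomorphicRep (adelicGroupData (↥(maximalRealSubfield L)) L (IsCMField.complexConj L) 3 H) μA)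
  (χ : Chi (↥(maximalRealSubfield L)) L (IsCMField.complexConj L))
  (Φf : FinSB (↥(maximalRealSubfield L)) (Fin 3 × Fin 1))

omit [NumberField L] [IsCMField L] in
/-- `2 ≤ n'` for `e₁ : Fin 3 × Fin 1 ≃ Fin n'` (`n' = 3`; the rank hypothesis of [Liu2021, Lem. D.1] ★ `isIrreducibleOrZero_rhoVAtLine_chiSplittingLine`). [folklore] -/
theorem two_le_of_equiv_fin_three_prod_fin_one (e₁ : Fin 3 × Fin 1 ≃ Fin n') : 2 ≤ n' := by
  have h := Fintype.card_congr e₁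
  simp only [Fintype.card_prod, Fintype.card_fin] at h
  omega

set_option maxHeartbeats 1600000 in
/-- **Node B′ in the frame of OCC♭∀ (`N = 3`, canonical `ιV`)**: `pr_P [Θ̃_{R_e E(Φ_∞ ⊗ Φ_f)}(charCM χ̃_χ) ∘ ιA] ≠ 0 ⟹ P.HasFinComponent (rhoAtLine … ιV a χ)`.
[cite: Liu2021, proof of Prop. 4.13 Case 1 (l. 2136–2137, p. 48) and l. 2145–2149; Def. 4.11 (l. 2090–2096); App. D Lemma D.1 (l. 5227)]
[cite: Rallis1984, Thm. 1.2.2 proof p. 356] [cite: BorelJacquet1979, §4.6] -/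
theorem hasFinComponent_rhoAtLine_three_of_starProjection_ne_zero
    (hne : haveI := normal_range_toAdelic_JW L a
      P.space.toSubmodule.starProjection
          (MemLp.toLp _ (memLp_toQuotFun_lineThetaLift L 3 H e₁ dV hdV hdV0 g hg μ hμ a hρ μW
            (piSBReindex (↥(maximalRealSubfield L)) e₁ (piSchwartzBruhatEquiv (↥(maximalRealSubfield L)) (Fin 3 × Fin 1) (φ ⊗ₜ[ℂ] Φf)))
            (charCM (chiQuot (↥(maximalRealSubfield L)) L (IsCMField.complexConj L) (Algebra.IsQuadraticExtension.finrank_eq_two _ L)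
              (IsCMField.complexConj_ne_one (K := L)) a χ)) μA 2)) ≠ 0) :
    P.HasFinComponent
      (rhoAtLine (↥(maximalRealSubfield L)) L (IsCMField.complexConj L) 3 e₁ (Matrix.diagonal dV)
        (complexConj_imagUnit L) (imagUnit_ne_zero L) (imagUnit_mul_self L) (realDiagonal_isSymm L dV hdV)
        (isUnit_det_realDiagonal L dV hdV hdV0) (realDiagonal_map L dV hdV).symm
        (fun b => isCompatible_chiSplittingLine L e₁ dV hdV hdV0 (toHeckeCharacter L μ)
          (isUnitary_toHeckeCharacter L μ) ((isOscillatorChar_toHeckeCharacter_iff μ).mpr hμ)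
          (TW (↥(maximalRealSubfield L)) b) (isSymm_TW (↥(maximalRealSubfield L)) b)
          (isUnit_det_TW (↥(maximalRealSubfield L)) b) (JW (↥(maximalRealSubfield L)) L b)
          (JW_eq (↥(maximalRealSubfield L)) L b))
        ((finPart (↥(maximalRealSubfield L)) L (IsCMField.complexConj L) 3 (Matrix.diagonal dV)).comp
          ((cmAdelicFrameTransport L 3 H dV g hg).comp (finAdelicToAdelic (↥(maximalRealSubfield L)) L (IsCMField.complexConj L) 3 H)))
        a χ) :=
  hasFinComponent_rhoAtLine_of_starProjection_ne_zero L 3 H e₁ (two_le_of_equiv_fin_three_prod_fin_one e₁) dV hdV hdV0 g hg μ hμ a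
    hρ μW φ P χ Φf hne

include hg in
set_option maxHeartbeats 1600000 in
/-- **Node B′ in the frame of OCC♭∀ (`N = 3`) at the PINNED `ιV`** (`↑(ιV k) = g_f⁻¹ · k · g_f`, the `hιV` binder of `StubOccFlatAdmissibleAll`):
`pr_P [Θ̃_{R_e E(Φ_∞ ⊗ Φ_f)}(charCM χ̃_χ) ∘ ιA] ≠ 0 ⟹ P.HasFinComponent (rhoAtLine … ιV a χ)` — the `HasFinComponent` conjunct of OCC♭∀'s conclusion
for the discrete `P` on which the theta class of `(a, χ)` projects non-trivially.
[cite: Liu2021, proof of Prop. 4.13 Case 1 (l. 2136–2137, p. 48) and l. 2145–2149; Def. 4.11 (l. 2090–2096); App. D Lemma D.1 (l. 5227)]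
[cite: Rallis1984, Thm. 1.2.2 proof p. 356] [cite: BorelJacquet1979, §4.1, §4.6] -/
theorem hasFinComponent_rhoAtLine_three_of_starProjection_ne_zero_of_coe
    (ιV : finAdelic (↥(maximalRealSubfield L)) L (IsCMField.complexConj L) 3 H →*
      finAdelic (↥(maximalRealSubfield L)) L (IsCMField.complexConj L) 3 (Matrix.diagonal dV))
    (hιV : ∀ k, ((ιV k : finAdelic (↥(maximalRealSubfield L)) L (IsCMField.complexConj L) 3 (Matrix.diagonal dV)) :
          GL (Fin 3) (FiniteAdeleRing (𝓞 L) L)) =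
        (toFinAdeleGL L 3 g)⁻¹ * (k : GL (Fin 3) (FiniteAdeleRing (𝓞 L) L)) * toFinAdeleGL L 3 g)
    (hne : haveI := normal_range_toAdelic_JW L a
      P.space.toSubmodule.starProjection
          (MemLp.toLp _ (memLp_toQuotFun_lineThetaLift L 3 H e₁ dV hdV hdV0 g hg μ hμ a hρ μW
            (piSBReindex (↥(maximalRealSubfield L)) e₁ (piSchwartzBruhatEquiv (↥(maximalRealSubfield L)) (Fin 3 × Fin 1) (φ ⊗ₜ[ℂ] Φf)))
            (charCM (chiQuot (↥(maximalRealSubfield L)) L (IsCMField.complexConj L) (Algebra.IsQuadraticExtension.finrank_eq_two _ L)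
              (IsCMField.complexConj_ne_one (K := L)) a χ)) μA 2)) ≠ 0) :
    P.HasFinComponent
      (rhoAtLine (↥(maximalRealSubfield L)) L (IsCMField.complexConj L) 3 e₁ (Matrix.diagonal dV)
        (complexConj_imagUnit L) (imagUnit_ne_zero L) (imagUnit_mul_self L) (realDiagonal_isSymm L dV hdV)
        (isUnit_det_realDiagonal L dV hdV hdV0) (realDiagonal_map L dV hdV).symm
        (fun b => isCompatible_chiSplittingLine L e₁ dV hdV hdV0 (toHeckeCharacter L μ)
          (isUnitary_toHeckeCharacter L μ) ((isOscillatorChar_toHeckeCharacter_iff μ).mpr hμ)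
          (TW (↥(maximalRealSubfield L)) b) (isSymm_TW (↥(maximalRealSubfield L)) b)
          (isUnit_det_TW (↥(maximalRealSubfield L)) b) (JW (↥(maximalRealSubfield L)) L b)
          (JW_eq (↥(maximalRealSubfield L)) L b)) ιV a χ) :=
  hasFinComponent_rhoAtLine_of_starProjection_ne_zero_of_coe L 3 H e₁ (two_le_of_equiv_fin_three_prod_fin_one e₁) dV hdV hdV0 g hg μ
    hμ a hρ μW φ P χ Φf ιV hιV hne

end RankThree

end Summit.HodgeConjecture.HodgeConjecture.Cruxes.H413.F0P2sNodeBPrime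

end
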